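/-
COR-CM (cell pub-hodgecm2, stage 2 of the Hodge ladder) — count-neutral KERNEL CENSUS TRANSPORT «the MARKMAN COLUMN of the cyclic
decic type» (seat prover-pub-hodgecm2-b09-g21-0, binder prover b09, gen 21; own lane DECIC-MARKMAN-TRANSPORT, HOME/INBOX.md
l.4703/l.4704/l.4892; sequel of seat b23's `Census/DecicFaceTransport.lean` and of `CorCM/FacePeriodsKnownProducts.lean`,
`CorCM/FaceCensusKnownProducts.lean`; seat b30's census data `Census/DecicFaceSquaresCyclic.lean` BY NAME).  Theorems only: one closed
kernel identity over the 32 CM-type codes (`decide`), its transport, and the resulting closed field-closure theorem; no definition,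
no named fact, nothing asserted; `Interfaces.lean` (C1), every E term, `B01/*`, `Transposition/*` untouched.
HONEST FRAMING (COORDINATOR RULING — HODGE FRAMING CORRECTION, 2026-08-21T11:55:35Z): `HC_CM` is NOT proved, here or anywhere in the
tree.  The closing theorem is CONDITIONAL on TWO face periods of ONE field and on the Hodge conjecture of ONE product
`A_{(K,Θ_odd)} × A_{(K,Φ₀)}` of the tree (supplied modulo Markman's sixfold theorem by `CorCM/DecicInducedTimesHalfCircleHodgeOfMarkman.lean`).
T5 (coordinator ruling 15:33:56Z (3)): binder set of §3 = b23's landed set {dictionary (e, hmul, hconj), face readings, face periods}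
MINUS one face period PLUS {`hΘ` (a type reading, inhabited: `FaceCensus.exists_of_isCMType`), `hHC` (an instance of the Hodge
conjecture; no `¬` theorem in the tree)}; no contradiction derivable; checker: self (prover-pub-hodgecm2-b09-g21-0), 2026-08-21.
-/
import Summits.HodgeConjecture.CorCM.Census.DecicFaceTransport
import Summits.HodgeConjecture.CorCM.FaceCensusKnownProducts
import Summits.HodgeConjecture.CorCM.FacePeriodsKnownProducts
import HarnessLib

/-!
# Degree 10, cyclic type: TWO face periods + the Markman column close the slice (census transport)

Seat b23's `DecicFaceTransport.Cyclic.hodgeConjectureFor_of_avDominatedBy_isProductOf_of_facePeriod_decicCyclic` closes the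
cyclic-decic slice of the Hodge conjecture from period witnesses on THREE faces reading as seat b30's generating representatives
`(31;33,66)`, `(31;33,132)`, `(31;66,264)`.  Here the third is replaced by a KNOWN PRODUCT: with `Θ_odd` the CM type reading as the
odd residues `{1,3,5,7,9}` (code `682`; the type induced from the imaginary quadratic subfield) and `Φ₀` the base type of the first
face (code `31`, the half-circle), the Hodge weight

  `S = ({σ₀}, {(e⁻¹u)⁻¹ σ₀ : u ∈ {0,2,4,6,8}})` on `A_{(K,Θ_odd)} × A_{(K,Φ₀)}`  (the pull-back of the Weil weight of the split sixfold
  `E × B₀`; §1: a Hodge weight, `isHodgeWeight_markman`)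

satisfies the CERTIFICATE (§2 `cert_F3`, a closed `decide` over the 32 CM-type codes; exact model `work/decic_cert_check.py`)

  `1_{corners (31;66,264)} + 1_S = 1_{corners (31;33,66)} + 1_{corners g₈·(31;33,66)} + (1_{341} + 1_{682})`

i.e. FACE 3 + MARKMAN = FACE 1 + FACE 1 TWISTED BY `g₈` + the divisor pair of the `k`-types.  Transported (b23's
`FaceCensus.mem_of_eval_eq_comboVal`, `weightRel_corner_apply`; base change and quotient `CorCM/FaceCensusKnownProducts.lean`) it puts every
Weil character of a face reading `(31;66,264)` in the subgroup generated by the Weil characters of the faces reading `(31;33,66)`,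
`(31;33,132)` and the Hodge-weight characters of `![Θ_odd, Φ₀]` (§2 `hgen_decicCyclic_markman`, over b23's `hgen_decicCyclic`), whence
(§3, the enlarged transport `hodgeConjectureFor_of_avDominatedBy_isProductOf_of_exists_facePeriod_of_hodgeConjectureFor_on`):

  period witnesses on TWO faces of `K` reading `(31;33,66)`, `(31;33,132)` + `HodgeConjectureFor (A_{(K,Θ_odd)} × A_{(K,Φ₀)})`
    ⟹ the Hodge conjecture, in every codimension, for every abelian variety dominated by a product of realisations of CM types of
      CM fields embeddable in `K`.

LATTICE FACTS (exact, `work/decic_lattice.py`): in `Asym(ℤ/10) ≅ ℤ¹⁶` the Hodge characters span rank `11`; faces 1, 2 + this ONE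
weight generate them over `ℤ`; no single face + both Markman columns does (rank `7`): the deficiency of the cyclic decic slice modulo
Markman is exactly two faces.  `HC_CM` is NOT proved; no period is produced here.

References: [cite: Pohlmann1968, Thm. 1]; [cite: Milne1999LefschetzClasses, Thm. 3.2 and Cor. 4.5]; [cite: Shimura1998, §6.2
Theorem 3 and §6.1 Corollary of Theorem 2 (pp. 41–43)]; [cite: MumfordAV1970, §19 Thm. 1 and p. 169]; [cite: Markman2025SecantWeil,
Thm 1.5.1] (only through the hypothesis `hHC`).
-/

noncomputable section

open CategoryTheory NumberField NumberField.ComplexEmbedding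
open Literature.AlgebraicGeometry Literature.AlgebraicGeometry.Motives Literature.AlgebraicGeometry.HodgeTheory
open Literature.AlgebraicGeometry.ComplexMultiplication Literature.AlgebraicGeometry.Milne1999
open Literature.NumberTheory.Automorphic Literature.NumberTheory.Automorphic.PicardCM
open Literature.NumberTheory.ComplexMultiplication.CMTypeOps
open Summit.HodgeConjecture.CorCM.Prior.AllgGroup.RfwfAllgGroup
open Summit.HodgeConjecture.CorCM.Census.FaceSquaresModel
open Summit.HodgeConjecture.CorCM.Census.DecicFaceSquaresCyclic (Γ)
open Summit.HodgeConjecture.CorCM.FaceCensus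
open Summit.HodgeConjecture.CorCM.Domination

namespace Summit.HodgeConjecture.CorCM.DecicFaceTransport.CyclicMarkman

section Model

variable {F : Type} [Field F] [NumberField F] [IsGalois ℚ F] (e : GalT F ≃ Fin 10)

/-! ## §1 The Markman weight on `A_{Θ_odd} × A_{Φ₀}`: codes, Hodge property, evaluation -/

omit [IsGalois ℚ F] in
/-- Code of a type READ at `σ₀` through `e`. [folklore] -/
theorem code_of_reads (σ₀ : F →+* ℂ) (Θ : CMType F) {T : ℕ} (hT : T < 2 ^ 10)
    (h : ∀ P : GalT F, P.1 σ₀ ∈ Θ.1 ↔ mem (e P) T = true) :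
    T < 2 ^ 10 ∧ ∀ i : Fin 10, mem i T = true ↔ e.symm i ∈ (pullType Θ σ₀).1 :=
  ⟨hT, fun i => by rw [mem_pullType, h, e.apply_symm_apply]⟩

omit [IsGalois ℚ F] in
/-- A single type evaluates through its code. [folklore] -/
theorem single_apply_code {X Ψ : CMF (GalT F) conjT} {T S : ℕ}
    (hX : T < 2 ^ 10 ∧ ∀ i : Fin 10, mem i T = true ↔ e.symm i ∈ X.1)
    (hS : S < 2 ^ 10 ∧ ∀ i : Fin 10, mem i S = true ↔ e.symm i ∈ Ψ.1) :
    (Finsupp.single X (1 : ℤ)) Ψ = if S = T then 1 else 0 := by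
  rw [Finsupp.single_apply]
  by_cases h : X = Ψ
  · rw [if_pos h, if_pos ((eq_iff_code_eq e hX hS).mp h).symm]
  · rw [if_neg h, if_neg (fun h' => h ((eq_iff_code_eq e hX hS).mpr h'.symm))]

omit [IsGalois ℚ F] in
/-- **Code of the half-circle type read at the translate `(e⁻¹ u)⁻¹ σ₀`**: `Γ.twist u 31` (b23's `code_pullType_baseChange`).
[folklore] -/
theorem code_halfCircle_translate (hmul : ∀ P Q : GalT F, e (P * Q) = Γ.mul (e P) (e Q)) (σ₀ : F →+* ℂ) (Φ : CMType F)
    (hΦ : ∀ P : GalT F, P.1 σ₀ ∈ Φ.1 ↔ mem (e P) 31 = true) (u : Fin 10) :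
    Γ.twist u 31 < 2 ^ 10 ∧
      ∀ i : Fin 10, mem i (Γ.twist u 31) = true ↔ e.symm i ∈ (pullType Φ (((e.symm u)⁻¹).1 σ₀)).1 := by
  have h := code_pullType_baseChange Γ e hmul Φ σ₀ (e.symm u)⁻¹ (code_of_reads e σ₀ Φ (by norm_num) hΦ)
  rwa [inv_inv, e.apply_symm_apply] at h

/-- The translates `(e⁻¹ u)⁻¹ σ₀` are pairwise distinct (the action of `GalT F` on embeddings is free). [folklore] -/
theorem translate_inv_injective (σ₀ : F →+* ℂ) : Function.Injective (fun u : Fin 10 => ((e.symm u)⁻¹).1 σ₀) := by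
  intro u u' h
  have h' : (e.symm u)⁻¹ = (e.symm u')⁻¹ := GalT.ext_of_apply σ₀ h
  exact e.symm.injective (inv_injective h')

open scoped Classical in
/-- **The Markman weight is a Hodge weight** on `![Θ_odd, Φ₀]`: `S = ({σ₀}, {(e⁻¹u)⁻¹ σ₀ : u ∈ {0,2,4,6,8}})` has degree `6 = 2·3` and
every Galois translate of type `(3,3)` — a closed check on the ten residues through the codes `682` and `Γ.twist u 31`.
[cite: Pohlmann1968, Thm. 1] -/
theorem isHodgeWeight_markman (hmul : ∀ P Q : GalT F, e (P * Q) = Γ.mul (e P) (e Q)) (σ₀ : F →+* ℂ) (Θo Φ : CMType F)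
    (hΘ : ∀ P : GalT F, P.1 σ₀ ∈ Θo.1 ↔ mem (e P) 682 = true) (hΦ : ∀ P : GalT F, P.1 σ₀ ∈ Φ.1 ↔ mem (e P) 31 = true) :
    IsHodgeWeight ![Θo, Φ] 3
      ![{σ₀}, ({0, 2, 4, 6, 8} : Finset (Fin 10)).image (fun u => ((e.symm u)⁻¹).1 σ₀)] := by
  classical
  refine ⟨?_, fun P => ?_⟩
  · rw [Fin.sum_univ_two]
    simp only [Matrix.cons_val_zero, Matrix.cons_val_one, Finset.card_singleton]
    rw [Finset.card_image_of_injective _ (translate_inv_injective e σ₀)]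
    decide
  · rw [Fin.sum_univ_two]
    simp only [Matrix.cons_val_zero, Matrix.cons_val_one, Finset.sum_singleton]
    rw [Finset.sum_image (fun u _ u' _ h => translate_inv_injective e σ₀ h),
      Finset.sum_insert (by decide), Finset.sum_insert (by decide), Finset.sum_insert (by decide),
      Finset.sum_insert (by decide), Finset.sum_singleton]
    have h0 : ind Θo (P.1 σ₀) = if mem (e P) 682 = true then 1 else 0 := by
      unfold ind; congr 1; exact propext (hΘ P)
    have hu : ∀ u : Fin 10, ind Φ (P.1 (((e.symm u)⁻¹).1 σ₀)) = if mem (e P) (Γ.twist u 31) = true then 1 else 0 := by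
      intro u
      have hc := (code_halfCircle_translate e hmul σ₀ Φ hΦ u).2 (e P)
      rw [e.symm_apply_apply, mem_pullType] at hc
      unfold ind; congr 1; exact propext hc.symm
    rw [h0, hu 0, hu 2, hu 4, hu 6, hu 8]
    have key : ∀ i : Fin 10, ((if mem i 682 = true then (1 : ℤ) else 0) +
        ((if mem i (Γ.twist 0 31) = true then (1 : ℤ) else 0) + ((if mem i (Γ.twist 2 31) = true then (1 : ℤ) else 0) +
        ((if mem i (Γ.twist 4 31) = true then (1 : ℤ) else 0) + ((if mem i (Γ.twist 6 31) = true then (1 : ℤ) else 0) +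
        (if mem i (Γ.twist 8 31) = true then (1 : ℤ) else 0)))))) = 3 := by
      decide +kernel
    exact key (e P)

open scoped Classical in
/-- **The Markman weight evaluates through the codes**: at an abstract type with code `S` the weight relation of `S` on
`![Θ_odd, Φ₀]` is `[S = 682] + Σ_{u ∈ {0,2,4,6,8}} [S = Γ.twist u 31]`. [cite: Pohlmann1968, Thm. 1] -/
theorem weightRel_markman_apply (hmul : ∀ P Q : GalT F, e (P * Q) = Γ.mul (e P) (e Q)) (σ₀ : F →+* ℂ) (Θo Φ : CMType F)
    (hΘ : ∀ P : GalT F, P.1 σ₀ ∈ Θo.1 ↔ mem (e P) 682 = true) (hΦ : ∀ P : GalT F, P.1 σ₀ ∈ Φ.1 ↔ mem (e P) 31 = true)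
    (Ψ : CMF (GalT F) conjT) {S : ℕ} (hS : S < 2 ^ 10 ∧ ∀ i : Fin 10, mem i S = true ↔ e.symm i ∈ Ψ.1) :
    weightRel ![Θo, Φ] ![{σ₀}, ({0, 2, 4, 6, 8} : Finset (Fin 10)).image (fun u => ((e.symm u)⁻¹).1 σ₀)] Ψ =
      (if S = 682 then 1 else 0) + ((if S = Γ.twist 0 31 then 1 else 0) + ((if S = Γ.twist 2 31 then 1 else 0) +
        ((if S = Γ.twist 4 31 then 1 else 0) + ((if S = Γ.twist 6 31 then 1 else 0) + (if S = Γ.twist 8 31 then 1 else 0))))) := by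
  classical
  unfold weightRel
  rw [Fin.sum_univ_two]
  simp only [Matrix.cons_val_zero, Matrix.cons_val_one, Finset.sum_singleton]
  rw [Finset.sum_image (fun u _ u' _ h => translate_inv_injective e σ₀ h),
    Finset.sum_insert (by decide), Finset.sum_insert (by decide), Finset.sum_insert (by decide),
    Finset.sum_insert (by decide), Finset.sum_singleton]
  simp only [Finsupp.add_apply]
  rw [single_apply_code e (code_of_reads e σ₀ Θo (by norm_num) hΘ) hS,
    single_apply_code e (code_halfCircle_translate e hmul σ₀ Φ hΦ 0) hS,
    single_apply_code e (code_halfCircle_translate e hmul σ₀ Φ hΦ 2) hS,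
    single_apply_code e (code_halfCircle_translate e hmul σ₀ Φ hΦ 4) hS,
    single_apply_code e (code_halfCircle_translate e hmul σ₀ Φ hΦ 6) hS,
    single_apply_code e (code_halfCircle_translate e hmul σ₀ Φ hΦ 8) hS]

/-! ## §2 The certificate FACE 3 + MARKMAN = FACE 1 + FACE 1·g₈ + pair, and its transport -/

/-- **THE CERTIFICATE (closed kernel identity over the 32 CM-type codes of `(ℤ/10, c = 5)`).**  With b30's `Γ`:
`1_{corners (31;66,264)} + ([S=682] + Σ_{u even} [S = Γ.twist u 31]) = comboVal [((31,33,66),1), ((Γ.twist 8 31, Γ.twist 8 33,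
Γ.twist 8 66), 1)] [(341, 1)]` at every `S ∈ Γ.cmTypes`. [folklore] -/
theorem cert_F3 : ∀ S ∈ Γ.cmTypes,
    ((if (Γ.corners (31, 66, 264)).contains S then (1 : ℤ) else 0) +
      ((if S = 682 then 1 else 0) + ((if S = Γ.twist 0 31 then 1 else 0) + ((if S = Γ.twist 2 31 then 1 else 0) +
        ((if S = Γ.twist 4 31 then 1 else 0) + ((if S = Γ.twist 6 31 then 1 else 0) + (if S = Γ.twist 8 31 then 1 else 0))))))) =
      Γ.comboVal [((31, 33, 66), 1), ((Γ.twist 8 31, Γ.twist 8 33, Γ.twist 8 66), 1)] [(341, 1)] S := by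
  decide +kernel

/-- **FACE 3 lies in the enlarged module generated by FACE 1 and the Markman weight** (pre-quotient, at the base embedding): for
faces `R₁`, `R₃` of `F` reading as `(31;33,66)`, `(31;66,264)` at `σ₀`, a type `Θ_odd` reading as `682`, any `𝒮 ∋ R₁` and any `𝒲`
containing the family `![Θ_odd, R₁.Φ]`:  `weightRel R₃.corner (· ↦ {σ₀}) ∈ span ℤ Y(𝒮, 𝒲) ⊔ pairRel` — the certificate `cert_F3` unwound by
b23's `FaceCensus.mem_of_eval_eq_comboVal` over the single representative `(31,33,66)`. [cite: Pohlmann1968, Thm. 1] -/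
theorem weightRel_F3_mem_span_known (hmul : ∀ P Q : GalT F, e (P * Q) = Γ.mul (e P) (e Q)) (hconj : e conjT = Γ.conj)
    (σ₀ : F →+* ℂ) (𝒮 : Set (Face F)) (𝒲 : Set ((m : ℕ) × (Fin (m + 1) → CMType F))) (R₁ R₃ : Face F) (hR₁S : R₁ ∈ 𝒮)
    (hR₁ : (∀ P : GalT F, P.1 σ₀ ∈ R₁.Φ.1 ↔ mem (e P) 31 = true) ∧
      Γ.placeMask (e (translate σ₀ R₁.p)) = 33 ∧ Γ.placeMask (e (translate σ₀ R₁.p')) = 66)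
    (hR₃ : (31 < 2 ^ 10 ∧ ∀ i : Fin 10, mem i 31 = true ↔ e.symm i ∈ (pullType R₃.Φ σ₀).1) ∧
      Γ.placeMask (e (translate σ₀ R₃.p)) = 66 ∧ Γ.placeMask (e (translate σ₀ R₃.p')) = 264)
    (Θo : CMType F) (hΘ : ∀ P : GalT F, P.1 σ₀ ∈ Θo.1 ↔ mem (e P) 682 = true)
    (hW : (⟨1, ![Θo, R₁.Φ]⟩ : (m : ℕ) × (Fin (m + 1) → CMType F)) ∈ 𝒲) :
    weightRel R₃.corner (fun _ => ({σ₀} : Finset (F →+* ℂ))) ∈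
      Submodule.span ℤ {y : CMF (GalT F) conjT →₀ ℤ |
        (∃ g ∈ 𝒮, ∃ σ : F →+* ℂ, y = weightRel g.corner (fun _ => ({σ} : Finset (F →+* ℂ)))) ∨
        ∃ w ∈ 𝒲, ∃ (p' : ℕ) (S' : Fin (w.1 + 1) → Finset (F →+* ℂ)), IsHodgeWeight w.2 p' S' ∧ y = weightRel w.2 S'}
        ⊔ pairRel := by
  classical
  -- the combination `1_{corners R₃} + 1_{Markman weight}` is FACE 1 + FACE 1·g₈ + a pair
  have hv : weightRel R₃.corner (fun _ => ({σ₀} : Finset (F →+* ℂ))) +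
      weightRel ![Θo, R₁.Φ] ![{σ₀}, ({0, 2, 4, 6, 8} : Finset (Fin 10)).image (fun u => ((e.symm u)⁻¹).1 σ₀)] ∈
      Submodule.span ℤ {y : CMF (GalT F) conjT →₀ ℤ | ∃ g ∈ 𝒮, ∃ σ : F →+* ℂ,
        y = weightRel g.corner (fun _ => ({σ} : Finset (F →+* ℂ)))} ⊔ pairRel := by
    refine mem_of_eval_eq_comboVal Γ e hmul hconj σ₀ 𝒮 [(31, 33, 66)] ?_
      [((31, 33, 66), 1), ((Γ.twist 8 31, Γ.twist 8 33, Γ.twist 8 66), 1)] [(341, 1)] ?_ ?_ _ ?_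
    · intro r hr
      rw [List.mem_singleton] at hr
      subst hr
      exact ⟨R₁, hR₁S, code_of_reads e σ₀ R₁.Φ (by norm_num) hR₁.1, hR₁.2.1, hR₁.2.2⟩
    · intro gi hgi
      rw [List.mem_cons, List.mem_singleton] at hgi
      rcases hgi with rfl | rfl
      · exact ⟨(31, 33, 66), List.mem_singleton_self _, 0, by decide +kernel⟩
      · exact ⟨(31, 33, 66), List.mem_singleton_self _, 8, by decide +kernel⟩
    · intro pj hpj
      rw [List.mem_singleton] at hpj
      subst hpj
      decide +kernel
    · intro Ψ S hS
      rw [Finsupp.add_apply, weightRel_corner_apply Γ e hmul hconj R₃ σ₀ hR₃.1 Ψ hS, hR₃.2.1, hR₃.2.2,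
        weightRel_markman_apply e hmul σ₀ Θo R₁.Φ hΘ hR₁.1 Ψ hS]
      exact cert_F3 S (code_mem_cmTypes Γ e hmul hconj hS)
  -- subtract the Markman weight, which is a generator of the enlarged module
  have hW' : weightRel ![Θo, R₁.Φ] ![{σ₀}, ({0, 2, 4, 6, 8} : Finset (Fin 10)).image (fun u => ((e.symm u)⁻¹).1 σ₀)] ∈
      Submodule.span ℤ {y : CMF (GalT F) conjT →₀ ℤ |
        (∃ g ∈ 𝒮, ∃ σ : F →+* ℂ, y = weightRel g.corner (fun _ => ({σ} : Finset (F →+* ℂ)))) ∨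
        ∃ w ∈ 𝒲, ∃ (p' : ℕ) (S' : Fin (w.1 + 1) → Finset (F →+* ℂ)), IsHodgeWeight w.2 p' S' ∧ y = weightRel w.2 S'}
        ⊔ pairRel :=
    Submodule.mem_sup_left (Submodule.subset_span (Or.inr ⟨_, hW, 3, _, isHodgeWeight_markman e hmul σ₀ Θo R₁.Φ hΘ hR₁.1, rfl⟩))
  have hle : Submodule.span ℤ {y : CMF (GalT F) conjT →₀ ℤ | ∃ g ∈ 𝒮, ∃ σ : F →+* ℂ,
        y = weightRel g.corner (fun _ => ({σ} : Finset (F →+* ℂ)))} ⊔ pairRel ≤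
      Submodule.span ℤ {y : CMF (GalT F) conjT →₀ ℤ |
        (∃ g ∈ 𝒮, ∃ σ : F →+* ℂ, y = weightRel g.corner (fun _ => ({σ} : Finset (F →+* ℂ)))) ∨
        ∃ w ∈ 𝒲, ∃ (p' : ℕ) (S' : Fin (w.1 + 1) → Finset (F →+* ℂ)), IsHodgeWeight w.2 p' S' ∧ y = weightRel w.2 S'}
        ⊔ pairRel :=
    sup_le_sup_right (Submodule.span_mono fun y hy => Or.inl hy) _
  have h := Submodule.sub_mem _ (hle hv) hW'
  rwa [add_sub_cancel_right] at h

end Model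

/-! ## §2b The enlarged generation binder, type `ℤ/10` with the Markman column -/

open Summit.HodgeConjecture.CorCM.DecicFaceTransport.Cyclic (sideChecks hgen_decicCyclic)

/-- **The ENLARGED generation binder, type `ℤ/10` (cyclic decic; `c = 5`), Markman column.** `K` a Galois CM field with an enumeration
`e : GalT K ≃ Fin 10` multiplicative for b30's table with `e conjT = 5`; `σ₀` a base embedding; `𝒮` any set of faces containing faces
`R₁`, `R₂` READING AS `(31;33,66)`, `(31;33,132)`; `Θ_odd` a CM type reading as `682`; `𝒲` any set of families containing
`![Θ_odd, R₁.Φ]`.  Then the `σ₀`-Weil character of EVERY face of `K` lies in the subgroup generated by the Weil characters of `𝒮` and the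
Hodge-weight characters of `𝒲` (b23's three-face binder `hgen_decicCyclic` with the third face, which exists by
`FaceCensus.exists_face_reads`, eliminated through `weightRel_F3_mem_span_known` at every base embedding).
[cite: Pohlmann1968, Thm. 1] [cite: Milne1999LefschetzClasses, Thm. 3.2] -/
theorem hgen_decicCyclic_markman (K : CMField) [IsGalois ℚ K] (e : GalT K ≃ Fin 10)
    (hmul : ∀ P Q : GalT K, e (P * Q) = Γ.mul (e P) (e Q)) (hconj : e conjT = Γ.conj) (σ₀ : (K : Type) →+* ℂ)
    (𝒮 : Set (Face K)) (𝒲 : Set ((m : ℕ) × (Fin (m + 1) → CMType K))) (R₁ R₂ : Face K) (hR₁S : R₁ ∈ 𝒮) (hR₂S : R₂ ∈ 𝒮)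
    (hR₁ : (∀ P : GalT K, P.1 σ₀ ∈ R₁.Φ.1 ↔ mem (e P) 31 = true) ∧
      Γ.placeMask (e (translate σ₀ R₁.p)) = 33 ∧ Γ.placeMask (e (translate σ₀ R₁.p')) = 66)
    (hR₂ : (∀ P : GalT K, P.1 σ₀ ∈ R₂.Φ.1 ↔ mem (e P) 31 = true) ∧
      Γ.placeMask (e (translate σ₀ R₂.p)) = 33 ∧ Γ.placeMask (e (translate σ₀ R₂.p')) = 132)
    (Θo : CMType K) (hΘ : ∀ P : GalT K, P.1 σ₀ ∈ Θo.1 ↔ mem (e P) 682 = true)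
    (hW : (⟨1, ![Θo, R₁.Φ]⟩ : (m : ℕ) × (Fin (m + 1) → CMType K)) ∈ 𝒲) (f : Face K) :
    lefChar f.corner (fun _ => ({σ₀} : Finset ((K : Type) →+* ℂ))) ∈ AddSubgroup.closure
      {a : Asym K | (∃ g ∈ 𝒮, ∃ σ : (K : Type) →+* ℂ,
          a = lefChar g.corner (fun _ => ({σ} : Finset ((K : Type) →+* ℂ)))) ∨
        ∃ w ∈ 𝒲, ∃ (p' : ℕ) (S' : Fin (w.1 + 1) → Finset ((K : Type) →+* ℂ)),
          IsHodgeWeight w.2 p' S' ∧ a = lefChar w.2 S'} := by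
  -- a third face reading `(31;66,264)` exists; b23's binder over `insert R₃ 𝒮`
  obtain ⟨R₃, hT₃, hp₃, hq₃⟩ := exists_face_reads Γ e hmul hconj σ₀ (r := (31, 66, 264)) (by decide +kernel)
  have h3 := hgen_decicCyclic K e hmul hconj σ₀ (insert R₃ 𝒮) ⟨R₁, Set.mem_insert_of_mem _ hR₁S, hR₁⟩
    ⟨R₂, Set.mem_insert_of_mem _ hR₂S, hR₂⟩
    ⟨R₃, Set.mem_insert _ _, fun P => by rw [← mem_pullType, ← e.symm_apply_apply P, ← hT₃.2 (e P), e.symm_apply_apply],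
      hp₃, hq₃⟩ f
  refine ((AddSubgroup.closure_le _).mpr ?_) h3
  rintro a ⟨g, hg, σ, rfl⟩
  rcases (Set.mem_insert_iff.mp hg) with rfl | hg'
  · exact lefChar_corner_mem_closure_known_of_weightRel_mem 𝒮 𝒲 g σ₀
      (weightRel_F3_mem_span_known e hmul hconj σ₀ 𝒮 𝒲 R₁ g hR₁S hR₁ ⟨hT₃, hp₃, hq₃⟩ Θo hΘ hW) σ
  · exact AddSubgroup.subset_closure (Or.inl ⟨g, hg', σ, rfl⟩)

/-! ## §3 FIELD CLOSURE from TWO face periods and the Markman column -/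

/-- **FIELD CLOSURE, type `ℤ/10` (cyclic decic) — TWO face periods + ONE known product (headline).** `K` a Galois CM field with an
enumeration `e : GalT K ≃ Fin 10` of its Galois translates multiplicative for b30's table, `e conjT = 5`; `σ₀` a base embedding; faces
`R₁`, `R₂` of `K` READING AS `(31;33,66)`, `(31;33,132)`; a CM type `Θ_odd` of `K` reading as the odd residues (`682`).  ONE period
witness for each of `R₁`, `R₂` on the universe of record AND the Hodge conjecture for the tree's product
`cmProdAV K cmAbelianVarietyRealised_holds 1 ![Θ_odd, R₁.Φ] = A_{(K,Θ_odd)} × A_{(K,Φ₀)}` (supplied modulo Markman's sixfold theorem by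
`DecicInducedTimesHalfCircle.hodgeConjectureFor_cmProdAV_induced_halfCircle_of_markmanSixfold`) imply the Hodge conjecture, in every
codimension, for every complex abelian variety dominated by a finite product of abelian varieties realising CM types of CM fields
embeddable in `K`.  (FRAMING: conditional on these 2 face periods and on `hHC`; b23's theorem needs 3 periods; `HC_CM` is not proved.)
[cite: Shimura1998, §6.2 Theorem 3 and §6.1 Corollary of Theorem 2 (pp. 41–43)] [cite: Pohlmann1968, Thm. 1]
[cite: Milne1999LefschetzClasses, Thm. 3.2 and Cor. 4.5] [cite: MumfordAV1970, §19 Thm. 1 and p. 169] -/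
theorem hodgeConjectureFor_of_avDominatedBy_isProductOf_of_two_facePeriods_of_hodgeConjectureFor_decicCyclic (K : CMField)
    [IsGalois ℚ K] (e : GalT K ≃ Fin 10) (hmul : ∀ P Q : GalT K, e (P * Q) = Γ.mul (e P) (e Q)) (hconj : e conjT = Γ.conj)
    (σ₀ : (K : Type) →+* ℂ) (R₁ R₂ : Face K)
    (hR₁ : (∀ P : GalT K, P.1 σ₀ ∈ R₁.Φ.1 ↔ mem (e P) 31 = true) ∧
      Γ.placeMask (e (translate σ₀ R₁.p)) = 33 ∧ Γ.placeMask (e (translate σ₀ R₁.p')) = 66)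
    (hR₂ : (∀ P : GalT K, P.1 σ₀ ∈ R₂.Φ.1 ↔ mem (e P) 31 = true) ∧
      Γ.placeMask (e (translate σ₀ R₂.p)) = 33 ∧ Γ.placeMask (e (translate σ₀ R₂.p')) = 132)
    (Θo : CMType K) (hΘ : ∀ P : GalT K, P.1 σ₀ ∈ Θo.1 ↔ mem (e P) 682 = true)
    (hHC : HodgeConjectureFor (cmProdAV K cmAbelianVarietyRealised_holds 1 ![Θo, R₁.Φ]).dim
      (cmProdAV K cmAbelianVarietyRealised_holds 1 ![Θo, R₁.Φ]).X)
    (h₁ : ∃ ι₁ : K →+* ℂ, R₁.Admissible ι₁ ∧ ∃ (V : HermSpace3 K ι₁) (σ : K →+* ℂ),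
      (Model.picardCMUniverse exists_isReal_hodgeModel_holds hodgePQ_independent_of_hodgeModel_holds
        BallQuotient.ballQuotientUniformised_holds cmAbelianVarietyRealised_holds).PeriodNV ι₁ V K R₁.psi σ)
    (h₂ : ∃ ι₁ : K →+* ℂ, R₂.Admissible ι₁ ∧ ∃ (V : HermSpace3 K ι₁) (σ : K →+* ℂ),
      (Model.picardCMUniverse exists_isReal_hodgeModel_holds hodgePQ_independent_of_hodgeModel_holds
        BallQuotient.ballQuotientUniformised_holds cmAbelianVarietyRealised_holds).PeriodNV ι₁ V K R₂.psi σ)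
    {P A : AbelianVariety ℂ} (hP : AbelianVariety.IsProductOf (fun B : AbelianVariety ℂ =>
      ∃ (E : Type) (_ : Field E) (_ : NumberField E) (_ : IsCMField E) (_ : E →+* (K : Type)) (Φ : CMType E)
        (ι : 𝓞 E →+* End B) (θ : E →+* Module.End ℂ (complexBetti B.X 1)),
        IsCMTypeRealisation Φ B ι θ) P)
    (hA : AVDominatedBy A P) : HodgeConjectureFor A.dim A.X :=
  hodgeConjectureFor_of_avDominatedBy_isProductOf_of_exists_facePeriod_of_hodgeConjectureFor_on K
    ((show 6 ≤ 10 by decide).trans_eq (FaceCensus.eq_finrank_of_enum e)) {R₁, R₂}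
    {(⟨1, ![Θo, R₁.Φ]⟩ : (m : ℕ) × (Fin (m + 1) → CMType K))}
    (fun w hw => by rw [Set.mem_singleton_iff] at hw; subst hw; exact hHC) σ₀
    (hgen_decicCyclic_markman K e hmul hconj σ₀ {R₁, R₂} _ R₁ R₂ (by simp) (by simp) hR₁ hR₂ Θo hΘ
      (Set.mem_singleton _))
    (fun f hf => by
      simp only [Set.mem_insert_iff, Set.mem_singleton_iff] at hf
      rcases hf with rfl | rfl
      · exact h₁
      · exact h₂) hP hA

end Summit.HodgeConjecture.CorCM.DecicFaceTransport.CyclicMarkman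

end
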